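import Summits.QuantumFields.BalabanUV.Beta.D1BFx.SortedReblocking
import Summits.QuantumFields.BalabanUV.Beta.D1BFx.PackedKernelSplit

/-!
# `BalabanUV.Beta.D1BFx.SortedPack` — road «BF-x», binder row D1, slot (K), debt X₃(ii) ROUTE T, brick **TA1** PART 3:
# THE CELL'S EMBEDDED (field ⊕ multiplier) PACKS AS HONEST TWO-SORTED KERNELS — a packed kernel `K : MKer D (F ⊕ F)` whose multiplier legs live on
# the coarse sublattice `n•ℤ^D` (the convention of `OneStepResolventKernel.KInv`, `KInvStep`, `coDressKBmAt`, `PackedKernelSplit.packK`) read over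
# the COARSE lattice with fibre `((ℤ∕n)^D × F) ⊕ F` (fine bonds ⊕ coarse bonds); `comp ↦ compF` (the off-lattice multiplier entries being `0`),
# block covariance ⟹ joint periodicity, `Decays ⟹` row bounds; and the THREE-SORTED torus KKT matrix `kkt Ĥ (fromRows Q̂ τ̂)` of the model
# (`SliceTransferJetsMixed`) as ONE periodised packed kernel with its bordered Lemma 2.2.2

WHY (K-ASSEMBLY-SPEC v1 §1 TA1, Tier B consumers).  TB1 (M-side) must show: the torus comb-gauged KKT matrix `kkt K̂₀ (fromRows Q̂₀ τ_T)` is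
invertible with `(ν ⊕ μ)`-blocks = the periodised dressed pack; TB2 (N-side): `kkt (K̂₀ + P̂₀ᵀP̂₀) Q̂₀` has inverse blocks = periodised
`(Γ_R, ℋ_R, ℋ♭_R, −Cun′)`.  With PARTS 1–2 and this file each reduces to ONE `ℤ^D` identity `compF T S = δ` between SORTED kernels, where the
cell's packed `MKer D (F ⊕ F)` objects enter through `sortK` (§1) and their `comp`-identities through `sortK_comp` (§2); the torus side is then
`kkt_fromRows_periodiseF_inv` (§4) — no torus linear algebra is left to the Tier-B seats.
CONTENT (all [folklore] ∕ [our object]; generic `D`, `F`, `n ≥ 1`):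
* §1 [our object] the sort injection `ι : ((ℤ∕n)^D × F) ⊕ F → (ℤ∕n)^D × (F ⊕ F)` (coarse legs at in-block position `0`), **`sortK n K`**
  (`:= reblock n K` read through `ι`), `finePt_zero` (`finePt n y 0 = n • y`), the four block readers `sortK_inl_inl` … `sortK_inr_inr`
  (entries of `K` at fine points ∕ coarse points `n • y`), `fTL_sortK` (the ff block IS `reblock n (blk K true true)`), `sortK_trK`, `blockCov_of_neg`,
  **`sortK_idK`**; `toBlocks₁₁_blocksHat_sortK`.
* §2 [folklore] **`sortK_comp`**: `sortK n (comp A K) = compF (sortK n A) (sortK n K)` for tame `A`, `K` when the multiplier ROWS of `K` vanish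
  off the coarse sublattice (`Torus.proj n y ≠ 0 → K y z (inr f) b = 0` — the shape of `OneStepResolventKernel.KInv_inr_off`,
  `BorderedHessianKernel.bhK_inr_row_off`); variant `sortK_comp'` with the hypothesis on the multiplier COLUMNS of `A` (`bhK_inr_col_off`).
* §3 [folklore] `isPeriodic₂_sortK` (block covariance ⟹ jointly `p`-periodic fibres, every `p`), `summable_abs_sortK`, `summable_sortK`,
  `rowBound_sortK` (`Decays ⟹` row bound `C·Zl D δ`).
* §4 [folklore] THREE SORTS: the re-indexing `e₃ : Site × (α ⊕ (β ⊕ γ)) ≃ (Site × α) ⊕ ((Site × β) ⊕ (Site × γ))`,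
  **`kkt_fromRows_periodiseF`** (`kkt Ĥ (fromRows Q̂ τ̂) = reindex e₃ e₃ ((fpack H (trF (frows Q τ)) (frows Q τ) 0)^)`) and the bordered Lemma 2.2.2
  in that form **`kkt_fromRows_periodiseF_mul_eq_one`** ∕ **`kkt_fromRows_periodiseF_inv`** ∕ `…_det_ne_zero` (the `hM` nondegeneracy of
  `mixedVar_sliceTransfer_jets` for `M_T`).
NOT HERE: the road's letters (TB1∕TB2), arrays (TA2), traces (TA3), estimates.

HONEST FRAMING (cell contract, verbatim): «discharging `BetaPertH` makes Bałaban's UV stability UNCONDITIONAL — a real constructive-QFT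
result; it is NOT the continuum limit and NOT the Clay problem.»  HONEST DEPENDENCY (verbatim): «continuum YM on T⁴ ⇐ BetaPertH ∧ nine
spine estimates (0/9 proved); BetaPertH ⇐ (D1) ∧ (D4) ∧ CAP+tail; G-an2-4 gates asym, D1 and NE2/3/4.»  [folklore] bookkeeping; no `Prop` is
minted, nothing is cited, no wall binder is instantiated; 0 sorry.  NOT D1, NOT BetaPertH, NOT summit progress.  ABSOLUTE RULE (cell,
verbatim): «No internally-minted statement may enter as a cited fact. Every hypothesis is either kernel-proved in this package or a verbatim
quotation of a PUBLISHED theorem with page reference. The manuscript(s) under audit are NOT citable for their own disputed steps — they are the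
thing under adjudication; programme-internal (2001/route/tribunal) claims are never citable.»
Provenance: D1 formalisation swarm, unit `b2b-balaban-beta-d1-formalise-leaf-03` (gen 8), claim «K-TA1», 2026-08-20.
-/

noncomputable section

namespace Summit.QuantumFields.BalabanUV.Beta.D1BFx.SortedPack

open Literature.Probability.LatticeModels (TorusSite Torus.proj Torus.proj_apply)
open Literature.MathematicalPhysics.QuantumFieldTheory.LatticeForm (repZ quo)
open Literature.MathematicalPhysics.QuantumFieldTheory.Balaban1983to89
open Literature.MathematicalPhysics.QuantumFieldTheory.Balaban1983to89.Beta
open Literature.MathematicalPhysics.QuantumFieldTheory.Balaban1983to89.Beta.Composition (kkt)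
open Literature.MathematicalPhysics.QuantumFieldTheory.Balaban1983to89.Beta.BlochFibreMatrix (repZ_zero)
open ExpKernelCalculus (MKer Decays comp shiftK Zl)
open Summit.QuantumFields.BalabanUV.Beta.TameKernelCalculus (Tame slice_tame trK)
open Summit.QuantumFields.BalabanUV.Beta.D1BFx.FibredPeriodisation
open Summit.QuantumFields.BalabanUV.Beta.D1BFx.SortedKernels
open Summit.QuantumFields.BalabanUV.Beta.D1BFx.SortedReblocking
open Summit.QuantumFields.BalabanUV.Beta.D1BFx.PackedKernelSplit (blk blk_tt)
open scoped BigOperators Matrix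

variable {D : ℕ} {F : Type*} {n : ℕ}

/-! ## §1 The embedded pack as a two-sorted kernel over the coarse lattice -/

/-- [our object] THE SORT INJECTION: a fine-bond fibre `(z, a)` is the packed fibre `(z, inl a)`; a coarse-bond fibre `a` is the packed fibre at
in-block position `0`, `(0, inr a)` (multiplier legs sit at the coarse points `n • y = finePt n y 0`). -/
def ι : (TorusSite D n × F) ⊕ F → TorusSite D n × (F ⊕ F)
  | Sum.inl za => (za.1, Sum.inl za.2)
  | Sum.inr a => (0, Sum.inr a)

/-- [our object] `ι` on a fine-bond fibre. -/
@[simp] theorem ι_inl (z : TorusSite D n) (a : F) : ι (Sum.inl (z, a)) = (z, Sum.inl a) := rfl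
/-- [our object] `ι` on a coarse-bond fibre. -/
@[simp] theorem ι_inr (a : F) : ι (D := D) (n := n) (Sum.inr a) = (0, Sum.inr a) := rfl

/-- [our object] **THE SORTED FORM OF AN EMBEDDED PACK**: `sortK n K ((y, i)) ((y′, j)) := reblock n K (y, ι i) (y′, ι j)`. -/
def sortK (n : ℕ) (K : MKer D (F ⊕ F)) : FKer D ((TorusSite D n × F) ⊕ F) ((TorusSite D n × F) ⊕ F) :=
  fun i j => reblock n K (i.1, ι i.2) (j.1, ι j.2)

/-- [our object] Unfolding of `sortK` through `reblock`. -/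
theorem sortK_apply (K : MKer D (F ⊕ F)) (y y' : Fin D → ℤ) (i j : (TorusSite D n × F) ⊕ F) :
    sortK n K (y, i) (y', j) = reblock n K (y, ι i) (y', ι j) := rfl

/-- [folklore] The coarse point of block `y` is its fine point at in-block position `0`: `finePt n y 0 = n • y`. -/
theorem finePt_zero (y : Fin D → ℤ) : finePt n y (0 : TorusSite D n) = (n : ℤ) • y := by
  rw [finePt, repZ_zero, zero_add]

/-- [our object] ff entries: `K` at two fine points, field legs. -/
theorem sortK_inl_inl (K : MKer D (F ⊕ F)) (y y' : Fin D → ℤ) (z z' : TorusSite D n) (a b : F) :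
    sortK n K (y, Sum.inl (z, a)) (y', Sum.inl (z', b)) = K (finePt n y z) (finePt n y' z') (Sum.inl a) (Sum.inl b) := rfl
/-- [our object] fm entries: `K` at a fine point and a coarse point `n • y′`. -/
theorem sortK_inl_inr (K : MKer D (F ⊕ F)) (y y' : Fin D → ℤ) (z : TorusSite D n) (a b : F) :
    sortK n K (y, Sum.inl (z, a)) (y', Sum.inr b) = K (finePt n y z) ((n : ℤ) • y') (Sum.inl a) (Sum.inr b) := by
  rw [sortK_apply, ι_inl, ι_inr, reblock_apply, finePt_zero]
/-- [our object] mf entries: `K` at a coarse point `n • y` and a fine point. -/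
theorem sortK_inr_inl (K : MKer D (F ⊕ F)) (y y' : Fin D → ℤ) (z' : TorusSite D n) (a b : F) :
    sortK n K (y, Sum.inr a) (y', Sum.inl (z', b)) = K ((n : ℤ) • y) (finePt n y' z') (Sum.inr a) (Sum.inl b) := by
  rw [sortK_apply, ι_inl, ι_inr, reblock_apply, finePt_zero]
/-- [our object] mm entries: `K` at two coarse points. -/
theorem sortK_inr_inr (K : MKer D (F ⊕ F)) (y y' : Fin D → ℤ) (a b : F) :
    sortK n K (y, Sum.inr a) (y', Sum.inr b) = K ((n : ℤ) • y) ((n : ℤ) • y') (Sum.inr a) (Sum.inr b) := by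
  rw [sortK_apply, ι_inr, ι_inr, reblock_apply, finePt_zero, finePt_zero]

/-- [our object] The ff block of the sorted pack IS the re-blocked ff block of the pack. -/
theorem fTL_sortK (K : MKer D (F ⊕ F)) : fTL (sortK n K) = reblock n (blk K true true) := rfl

/-- [our object] Fibres of `sortK` are fibres of `reblock` at the injected fibre indices. -/
theorem Kfib_sortK (K : MKer D (F ⊕ F)) (i j : (TorusSite D n × F) ⊕ F) : Kfib (sortK n K) i j = Kfib (reblock n K) (ι i) (ι j) := rfl

/-- [our object] Sorting commutes with transposition: `sortK n (trK K) = trF (sortK n K)`. -/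
theorem sortK_trK (K : MKer D (F ⊕ F)) : sortK n (trK K) = trF (sortK n K) := rfl

/-- [folklore] Block covariance stated with `−(n • t)` (the tree's `shiftK_KInv`∕`shiftK_coDressKBmAt_KInvStep` convention) gives the `+` form. -/
theorem blockCov_of_neg {K : MKer D (F ⊕ F)} (h : ∀ t : Fin D → ℤ, shiftK (-((n : ℤ) • t)) K = K) (t : Fin D → ℤ) :
    shiftK ((n : ℤ) • t) K = K := by
  have := h (-t)
  rwa [smul_neg, neg_neg] at this

/-- [folklore] **THE SORTED IDENTITY**: `sortK n idK = kdeltaF` (so a `comp`-inverse pair of packs sorts to a `compF`-inverse pair, §2). -/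
theorem sortK_idK [NeZero n] [DecidableEq F] :
    sortK n (HessKerSchurResolvent.idK : MKer D (F ⊕ F))
      = (kdeltaF : FKer D ((TorusSite D n × F) ⊕ F) ((TorusSite D n × F) ⊕ F)) := by
  funext ⟨y, i⟩ ⟨y', j⟩
  rcases i with ⟨z, a⟩ | a <;> rcases j with ⟨z', b⟩ | b <;>
    simp [sortK_apply, reblock_apply, HessKerSchurResolvent.idK_apply, kdeltaF, finePt_eq_iff, and_assoc]

/-! ## §2 Composition: `comp ↦ compF` (the off-lattice multiplier entries vanish) -/

section Comp
variable [NeZero n] [Fintype F]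

/-- [folklore] The packed fibre sum over `(ℤ∕n)^D × (F ⊕ F)` splits into the fine-bond fibres `(w, inl f)` and the multiplier fibres `(w, inr f)`. -/
theorem sum_fibre_split (g : TorusSite D n × (F ⊕ F) → ℝ) :
    ∑ c, g c = (∑ wf : TorusSite D n × F, g (wf.1, Sum.inl wf.2)) + ∑ wf : TorusSite D n × F, g (wf.1, Sum.inr wf.2) := by
  rw [Fintype.sum_prod_type, Fintype.sum_prod_type, Fintype.sum_prod_type, ← Finset.sum_add_distrib]
  refine Finset.sum_congr rfl fun w _ => ?_
  exact Fintype.sum_sum_type _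

/-- [folklore] If the multiplier rows of `K` vanish off the coarse sublattice, the multiplier fibres at in-block positions `w ≠ 0` drop out of a
middle sum. -/
theorem sum_inr_fibre_eq_single {K : MKer D (F ⊕ F)} (hK : ∀ y z f b, Torus.proj n y ≠ 0 → K y z (Sum.inr f) b = 0)
    (A : MKer D (F ⊕ F)) (X X' : Fin D → ℤ) (a b : F ⊕ F) :
    ∑ wf : TorusSite D n × F, ∑' y, A X (finePt n y wf.1) a (Sum.inr wf.2) * K (finePt n y wf.1) X' (Sum.inr wf.2) b
      = ∑ f : F, ∑' y, A X (finePt n y 0) a (Sum.inr f) * K (finePt n y 0) X' (Sum.inr f) b := by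
  rw [Fintype.sum_prod_type, Finset.sum_eq_single (0 : TorusSite D n)]
  · intro w _ hw
    refine Finset.sum_eq_zero fun f _ => ?_
    have h0 : ∀ y, K (finePt n y w) X' (Sum.inr f) b = 0 := fun y => hK _ _ _ _ (by rw [proj_finePt]; exact hw)
    simp only [h0, mul_zero, tsum_zero]
  · intro h; exact absurd (Finset.mem_univ _) h

/-- [folklore] **THE SORTED FORM IS MULTIPLICATIVE**: `sortK (A ∘ K) = sortK A ∘ sortK K` for tame `A`, `K` whose multiplier ROWS (of `K`)
vanish off the coarse sublattice `n•ℤ^D` — the fine middle sum of `comp` re-blocked (`reblock_comp`), its multiplier fibres at `w ≠ 0` being `0`. -/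
theorem sortK_comp {A K : MKer D (F ⊕ F)} (hA : Tame A) (hKt : Tame K)
    (hK : ∀ y z f b, Torus.proj n y ≠ 0 → K y z (Sum.inr f) b = 0) :
    sortK n (comp A K) = compF (sortK n A) (sortK n K) := by
  funext ⟨y, i⟩ ⟨y', j⟩
  rw [sortK_apply, reblock_comp_tame hA hKt]
  simp only [compF, sortK_apply, Fintype.sum_sum_type, reblock, ι_inr]
  rw [sum_fibre_split]
  congr 1
  exact sum_inr_fibre_eq_single hK A _ _ _ _

/-- [folklore] Column form of `sum_inr_fibre_eq_single`: the hypothesis on the multiplier COLUMNS of the left factor. -/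
theorem sum_inr_fibre_eq_single' {A : MKer D (F ⊕ F)} (hA : ∀ x y a f, Torus.proj n y ≠ 0 → A x y a (Sum.inr f) = 0)
    (K : MKer D (F ⊕ F)) (X X' : Fin D → ℤ) (a b : F ⊕ F) :
    ∑ wf : TorusSite D n × F, ∑' y, A X (finePt n y wf.1) a (Sum.inr wf.2) * K (finePt n y wf.1) X' (Sum.inr wf.2) b
      = ∑ f : F, ∑' y, A X (finePt n y 0) a (Sum.inr f) * K (finePt n y 0) X' (Sum.inr f) b := by
  rw [Fintype.sum_prod_type, Finset.sum_eq_single (0 : TorusSite D n)]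
  · intro w _ hw
    refine Finset.sum_eq_zero fun f _ => ?_
    have h0 : ∀ y, A X (finePt n y w) a (Sum.inr f) = 0 := fun y => hA _ _ _ _ (by rw [proj_finePt]; exact hw)
    simp only [h0, zero_mul, tsum_zero]
  · intro h; exact absurd (Finset.mem_univ _) h

/-- [folklore] `sortK_comp` with the off-lattice hypothesis on the multiplier COLUMNS of the LEFT factor. -/
theorem sortK_comp' {A K : MKer D (F ⊕ F)} (hAt : Tame A) (hKt : Tame K)
    (hA : ∀ x y a f, Torus.proj n y ≠ 0 → A x y a (Sum.inr f) = 0) :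
    sortK n (comp A K) = compF (sortK n A) (sortK n K) := by
  funext ⟨y, i⟩ ⟨y', j⟩
  rw [sortK_apply, reblock_comp_tame hAt hKt]
  simp only [compF, sortK_apply, Fintype.sum_sum_type, reblock, ι_inr]
  rw [sum_fibre_split]
  congr 1
  exact sum_inr_fibre_eq_single' hA K _ _ _ _

end Comp

/-! ## §3 Periodicity and row bounds of the sorted pack -/

/-- [folklore] Block covariance of the pack ⟹ every fibre of the sorted pack is jointly `p`-periodic on the coarse lattice, for every `p`. -/
theorem isPeriodic₂_sortK {K : MKer D (F ⊕ F)} (hK : ∀ t : Fin D → ℤ, shiftK ((n : ℤ) • t) K = K) (p : ℕ)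
    (i j : (TorusSite D n × F) ⊕ F) : IsPeriodic₂ p (Kfib (sortK n K) i j) := by
  rw [Kfib_sortK]; exact isPeriodic₂_reblock hK p _ _

/-- [folklore] `Decays ⟹` absolutely summable rows of every fibre of the sorted pack. -/
theorem summable_abs_sortK [NeZero n] [Fintype F] {K : MKer D (F ⊕ F)} {C δ : ℝ} (hK : Decays K C δ) (hδ : 0 < δ)
    (i j : (TorusSite D n × F) ⊕ F) (y : Fin D → ℤ) : Summable fun y' => |Kfib (sortK n K) i j y y'| := by
  rw [Kfib_sortK]; exact summable_abs_reblock hK hδ _ _ y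

/-- [folklore] `Decays ⟹` summable rows of every fibre of the sorted pack. -/
theorem summable_sortK [NeZero n] [Fintype F] {K : MKer D (F ⊕ F)} {C δ : ℝ} (hK : Decays K C δ) (hδ : 0 < δ)
    (i j : (TorusSite D n × F) ⊕ F) (y : Fin D → ℤ) : Summable (Kfib (sortK n K) i j y) :=
  (summable_abs_sortK hK hδ i j y).of_abs

/-- [folklore] `Decays ⟹` the uniform row bound `C·Zl D δ` for every fibre of the sorted pack. -/
theorem rowBound_sortK [NeZero n] [Fintype F] {K : MKer D (F ⊕ F)} {C δ : ℝ} (hK : Decays K C δ) (hδ : 0 < δ)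
    (i j : (TorusSite D n × F) ⊕ F) : RowBound (Kfib (sortK n K) i j) (C * Zl D δ) := by
  rw [Kfib_sortK]; exact rowBound_reblock hK hδ _ _

/-- [folklore] The ff block of the torus block matrix of a sorted pack is the periodised re-blocked ff block of the pack. -/
theorem toBlocks₁₁_blocksHat_sortK {p : ℕ} [NeZero p] (K : MKer D (F ⊕ F)) :
    (blocksHat p (sortK n K)).toBlocks₁₁ = Matrix.of (periodiseF p (reblock n (blk K true true))) := by
  rw [blocksHat, Matrix.toBlocks_fromBlocks₁₁, fTL_sortK]

/-! ## §4 Three sorts: the torus KKT matrix with stacked constraint rows -/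

section Three
variable {d : ℕ} {α β γ : Type*} {s : ℕ} [NeZero s]

/-- [our object] **FIBRED `fromRows`**: stacking two kernels with the same column sort into one kernel with row fibre `α ⊕ β`. -/
def frows (Q : FKer d α γ) (τ : FKer d β γ) : FKer d (α ⊕ β) γ
  | (x, Sum.inl a), j => Q (x, a) j
  | (x, Sum.inr b), j => τ (x, b) j

/-- [our object] Unfolding of `frows`, upper rows. -/
@[simp] theorem frows_inl (Q : FKer d α γ) (τ : FKer d β γ) (x : Fin d → ℤ) (a : α) (j : (Fin d → ℤ) × γ) :
    frows Q τ (x, Sum.inl a) j = Q (x, a) j := rfl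
/-- [our object] Unfolding of `frows`, lower rows. -/
@[simp] theorem frows_inr (Q : FKer d α γ) (τ : FKer d β γ) (x : Fin d → ℤ) (b : β) (j : (Fin d → ℤ) × γ) :
    frows Q τ (x, Sum.inr b) j = τ (x, b) j := rfl

/-- [folklore] Periodised stacked rows, upper entries. -/
theorem periodiseF_frows_inl (Q : FKer d α γ) (τ : FKer d β γ) (x y : Beta.Site d s) (a : α) (c : γ) :
    periodiseF s (frows Q τ) (x, Sum.inl a) (y, c) = periodiseF s Q (x, a) (y, c) := rfl
/-- [folklore] Periodised stacked rows, lower entries. -/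
theorem periodiseF_frows_inr (Q : FKer d α γ) (τ : FKer d β γ) (x y : Beta.Site d s) (b : β) (c : γ) :
    periodiseF s (frows Q τ) (x, Sum.inr b) (y, c) = periodiseF s τ (x, b) (y, c) := rfl

/-- [folklore] Periodisation commutes with row stacking: re-indexed, `(frows Q τ)^ = fromRows Q̂ τ̂`. -/
theorem reindex_periodiseF_frows (Q : FKer d α γ) (τ : FKer d β γ) :
    Matrix.reindex (Equiv.prodSumDistrib (Beta.Site d s) α β) (Equiv.refl _) (Matrix.of (periodiseF s (frows Q τ)))
      = Matrix.fromRows (Matrix.of (periodiseF s Q)) (Matrix.of (periodiseF s τ)) := by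
  ext i j
  obtain ⟨y, c⟩ := j
  rcases i with ⟨x, a⟩ | ⟨x, b⟩ <;>
    simp only [Matrix.reindex_apply, Matrix.submatrix_apply, Equiv.prodSumDistrib_symm_apply_left,
      Equiv.prodSumDistrib_symm_apply_right, Equiv.refl_symm, Equiv.refl_apply, Matrix.of_apply,
      Matrix.fromRows_apply_inl, Matrix.fromRows_apply_inr] <;> rfl

/-- [our object] The re-indexing of three sorts `Site × (α ⊕ (β ⊕ γ)) ≃ (Site × α) ⊕ ((Site × β) ⊕ (Site × γ))`. -/
def e₃ (s : ℕ) [NeZero s] (α β γ : Type*) :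
    Beta.Site d s × (α ⊕ (β ⊕ γ)) ≃ (Beta.Site d s × α) ⊕ ((Beta.Site d s × β) ⊕ (Beta.Site d s × γ)) :=
  (Equiv.prodSumDistrib _ α (β ⊕ γ)).trans (Equiv.sumCongr (Equiv.refl _) (Equiv.prodSumDistrib _ β γ))

/-- [our object] `e₃.symm` on the first sort. -/
@[simp] theorem e₃_symm_inl (x : Beta.Site d s) (a : α) :
    (e₃ s α β γ).symm (Sum.inl (x, a)) = (x, Sum.inl a) := rfl
/-- [our object] `e₃.symm` on the second sort. -/
@[simp] theorem e₃_symm_inr_inl (x : Beta.Site d s) (b : β) :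
    (e₃ s α β γ).symm (Sum.inr (Sum.inl (x, b))) = (x, Sum.inr (Sum.inl b)) := rfl
/-- [our object] `e₃.symm` on the third sort. -/
@[simp] theorem e₃_symm_inr_inr (x : Beta.Site d s) (c : γ) :
    (e₃ s α β γ).symm (Sum.inr (Sum.inr (x, c))) = (x, Sum.inr (Sum.inr c)) := rfl

omit [NeZero s] in
/-- [folklore] Joint periodicity of the fibres of stacked rows. -/
theorem isPeriodic₂_frows {Q : FKer d β α} {τ : FKer d γ α} (hQ : ∀ b a, IsPeriodic₂ s (Kfib Q b a))
    (hτ : ∀ c a, IsPeriodic₂ s (Kfib τ c a)) : ∀ i a, IsPeriodic₂ s (Kfib (frows Q τ) i a) := by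
  rintro (b | c) a
  exacts [hQ b a, hτ c a]

/-- [folklore] **THE THREE-SORTED TORUS KKT MATRIX IS A PERIODISED PACKED KERNEL**:
`kkt Ĥ (fromRows Q̂ τ̂) = reindex e₃ e₃ ((fpack H (frows Q τ)ᵀ (frows Q τ) 0)^)` (fibres of `Q`, `τ` jointly `s`-periodic). -/
theorem kkt_fromRows_periodiseF (H : FKer d α α) {Q : FKer d β α} {τ : FKer d γ α}
    (hQ : ∀ b a, IsPeriodic₂ s (Kfib Q b a)) (hτ : ∀ c a, IsPeriodic₂ s (Kfib τ c a)) :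
    kkt (Matrix.of (periodiseF s H)) (Matrix.fromRows (Matrix.of (periodiseF s Q)) (Matrix.of (periodiseF s τ)))
      = Matrix.reindex (e₃ s α β γ) (e₃ s α β γ)
          (Matrix.of (periodiseF s (fpack H (trF (frows Q τ)) (frows Q τ) (fun _ _ => 0)))) := by
  have hQτ := isPeriodic₂_frows hQ hτ
  ext i j
  rcases i with ⟨x, a⟩ | (⟨x, b⟩ | ⟨x, c⟩) <;> rcases j with ⟨y, a'⟩ | (⟨y, b'⟩ | ⟨y, c'⟩) <;>
    simp only [kkt, Matrix.reindex_apply, Matrix.submatrix_apply, e₃_symm_inl, e₃_symm_inr_inl, e₃_symm_inr_inr,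
      Matrix.fromBlocks_apply₁₁, Matrix.fromBlocks_apply₁₂, Matrix.fromBlocks_apply₂₁, Matrix.fromBlocks_apply₂₂,
      Matrix.transpose_apply, Matrix.fromRows_apply_inl, Matrix.fromRows_apply_inr, Matrix.of_apply, Matrix.zero_apply,
      periodiseF_fpack_inl_inl, periodiseF_fpack_inl_inr, periodiseF_fpack_inr_inl, periodiseF_fpack_inr_inr,
      periodiseF_trF_apply hQτ, periodiseF_frows_inl, periodiseF_frows_inr, periodiseF_zero_apply]

variable [Fintype α] [Fintype β] [Fintype γ] [DecidableEq α] [DecidableEq β] [DecidableEq γ]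

/-- [folklore] **BORDERED LEMMA 2.2.2, THREE SORTS, KKT FORM**: a two-sided `ℤ^d` inverse `S` of the packed operator
`fpack H (frows Q τ)ᵀ (frows Q τ) 0` (rows of `H`, `Q`, `τ` and columns of `Q`, `τ` absolutely summable; fibres of `Q`, `τ` jointly periodic;
fibres of `S` jointly periodic with a row bound) periodises to THE two-sided inverse of the torus matrix `kkt Ĥ (fromRows Q̂ τ̂)`. -/
theorem kkt_fromRows_periodiseF_mul_eq_one {H : FKer d α α} {Q : FKer d β α} {τ : FKer d γ α}
    {S : FKer d (α ⊕ (β ⊕ γ)) (α ⊕ (β ⊕ γ))} {B : ℝ}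
    (hH : ∀ a a' x, Summable fun y => |Kfib H a a' x y|)
    (hQr : ∀ b a x, Summable fun y => |Kfib Q b a x y|) (hQc : ∀ b a y, Summable fun x => |Kfib Q b a x y|)
    (hτr : ∀ c a x, Summable fun y => |Kfib τ c a x y|) (hτc : ∀ c a y, Summable fun x => |Kfib τ c a x y|)
    (hQp : ∀ b a, IsPeriodic₂ s (Kfib Q b a)) (hτp : ∀ c a, IsPeriodic₂ s (Kfib τ c a))
    (hS : ∀ i k, IsPeriodic₂ s (Kfib S i k)) (hSB : ∀ i k, RowBound (Kfib S i k) B)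
    (hTS : compF (fpack H (trF (frows Q τ)) (frows Q τ) (fun _ _ => 0)) S = kdeltaF) :
    kkt (Matrix.of (periodiseF s H)) (Matrix.fromRows (Matrix.of (periodiseF s Q)) (Matrix.of (periodiseF s τ)))
        * Matrix.reindex (e₃ s α β γ) (e₃ s α β γ) (Matrix.of (periodiseF s S)) = 1 ∧
      Matrix.reindex (e₃ s α β γ) (e₃ s α β γ) (Matrix.of (periodiseF s S))
        * kkt (Matrix.of (periodiseF s H)) (Matrix.fromRows (Matrix.of (periodiseF s Q)) (Matrix.of (periodiseF s τ))) = 1 := by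
  have hQτr : ∀ i a x, Summable fun y => |Kfib (frows Q τ) i a x y| := by
    rintro (b | c) a x
    exacts [hQr b a x, hτr c a x]
  have hQτc : ∀ i a y, Summable fun x => |Kfib (frows Q τ) i a x y| := by
    rintro (b | c) a y
    exacts [hQc b a y, hτc c a y]
  have hT := summable_abs_fpack hH (summable_abs_trF hQτc) hQτr (summable_abs_zeroF (d := d) (α := β ⊕ γ) (β := β ⊕ γ))
  obtain ⟨h1, h2⟩ := lemma222F hT hS hSB hTS
  rw [kkt_fromRows_periodiseF H hQp hτp, Matrix.reindex_apply, Matrix.reindex_apply]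
  exact ⟨by rw [Matrix.submatrix_mul_equiv, h1, Matrix.submatrix_one_equiv],
    by rw [Matrix.submatrix_mul_equiv, h2, Matrix.submatrix_one_equiv]⟩

/-- [folklore] **THE THREE-SORTED TORUS KKT INVERSE IS THE PERIODISED `ℤ^d` INVERSE** (hypotheses of `kkt_fromRows_periodiseF_mul_eq_one`). -/
theorem kkt_fromRows_periodiseF_inv {H : FKer d α α} {Q : FKer d β α} {τ : FKer d γ α}
    {S : FKer d (α ⊕ (β ⊕ γ)) (α ⊕ (β ⊕ γ))} {B : ℝ}
    (hH : ∀ a a' x, Summable fun y => |Kfib H a a' x y|)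
    (hQr : ∀ b a x, Summable fun y => |Kfib Q b a x y|) (hQc : ∀ b a y, Summable fun x => |Kfib Q b a x y|)
    (hτr : ∀ c a x, Summable fun y => |Kfib τ c a x y|) (hτc : ∀ c a y, Summable fun x => |Kfib τ c a x y|)
    (hQp : ∀ b a, IsPeriodic₂ s (Kfib Q b a)) (hτp : ∀ c a, IsPeriodic₂ s (Kfib τ c a))
    (hS : ∀ i k, IsPeriodic₂ s (Kfib S i k)) (hSB : ∀ i k, RowBound (Kfib S i k) B)
    (hTS : compF (fpack H (trF (frows Q τ)) (frows Q τ) (fun _ _ => 0)) S = kdeltaF) :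
    (kkt (Matrix.of (periodiseF s H)) (Matrix.fromRows (Matrix.of (periodiseF s Q)) (Matrix.of (periodiseF s τ))))⁻¹
      = Matrix.reindex (e₃ s α β γ) (e₃ s α β γ) (Matrix.of (periodiseF s S)) :=
  Matrix.inv_eq_right_inv (kkt_fromRows_periodiseF_mul_eq_one hH hQr hQc hτr hτc hQp hτp hS hSB hTS).1

/-- [folklore] In particular `det (kkt Ĥ (fromRows Q̂ τ̂)) ≠ 0` — the nondegeneracy `hM` of `mixedVar_sliceTransfer_jets` for `M_T`. -/
theorem kkt_fromRows_periodiseF_det_ne_zero {H : FKer d α α} {Q : FKer d β α} {τ : FKer d γ α}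
    {S : FKer d (α ⊕ (β ⊕ γ)) (α ⊕ (β ⊕ γ))} {B : ℝ}
    (hH : ∀ a a' x, Summable fun y => |Kfib H a a' x y|)
    (hQr : ∀ b a x, Summable fun y => |Kfib Q b a x y|) (hQc : ∀ b a y, Summable fun x => |Kfib Q b a x y|)
    (hτr : ∀ c a x, Summable fun y => |Kfib τ c a x y|) (hτc : ∀ c a y, Summable fun x => |Kfib τ c a x y|)
    (hQp : ∀ b a, IsPeriodic₂ s (Kfib Q b a)) (hτp : ∀ c a, IsPeriodic₂ s (Kfib τ c a))
    (hS : ∀ i k, IsPeriodic₂ s (Kfib S i k)) (hSB : ∀ i k, RowBound (Kfib S i k) B)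
    (hTS : compF (fpack H (trF (frows Q τ)) (frows Q τ) (fun _ _ => 0)) S = kdeltaF) :
    (kkt (Matrix.of (periodiseF s H)) (Matrix.fromRows (Matrix.of (periodiseF s Q)) (Matrix.of (periodiseF s τ)))).det ≠ 0 := by
  have h := (kkt_fromRows_periodiseF_mul_eq_one hH hQr hQc hτr hτc hQp hτp hS hSB hTS).1
  intro h0
  have := congrArg Matrix.det h
  rw [Matrix.det_mul, h0, zero_mul, Matrix.det_one] at this
  exact zero_ne_one this

end Three

end Summit.QuantumFields.BalabanUV.Beta.D1BFx.SortedPack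

end
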